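import Summits.QuantumFields.BalabanUV.Beta.MixedJetWard
import Summits.QuantumFields.BalabanUV.Beta.RootedMixedJetSingle

/-!
# `BalabanUV.Beta.MixedJetWardSingle` — binder row D1, «GAUGE-LETTERS» (G4-M, part 1): **THE JET WARD IDENTITY OF THE ROOTED MIXED JET
# AT SINGLE LETTERS, EVERY TERM A COUNT** (β sub-cell, BINDER-OWNERS row D1 OWNER, lineage an2 gen 21)

HONEST FRAMING (cell charter, verbatim): «discharging BetaPertH makes Balaban's UV stability UNCONDITIONAL — a real
constructive-QFT result; it is NOT the continuum limit and NOT the Clay problem.»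
HONEST DEPENDENCY: continuum YM on T⁴ ⇐ BetaPertH ∧ nine spine estimates (0/9 proved); BetaPertH ⇐ (D1) ∧ (D4) ∧ CAP+tail;
G-an2-4 gates asym, D1 and NE2/3/4.
DERIVED cell leaf ([folklore] letter algebra; BY NAME over G2 `MixedJetWard.MjetAt_gauge_counts`, node 7a∕7aρ `single`∕`bw_single`∕`hessUAt_single`∕
`linAvgAt_single`).  No statement of Bałaban's papers, no `[cite:]`, no `def`, no `Prop` fact.  Third module of the owner's route to the hW-side
bond law (WM-bond) of row D1; the analogue, for the GAUGE law, of an3's M3c `RootedMixedJetSingle.MjetAt_bref_of_single` for the reflection law.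
Discharges NO letter; 0∕4 binders (hW, hR, D1Tel, D1Rep).  NOT D1, NOT `BetaPertH`, NOT continuum, NOT Clay.

WHAT (`W = single F a`, `V = single F′ b`, gauge function `λ`, generator `D`; root `r = L·y + ρ`; `[x, z] = xz − zx`):
* §1 the rotation-defect components at single letters: `βg1_single` (`= single F (λ(x_F)•[D,a])`), `βg2_single` (`= single F′ (λ(x_{F′})•[D,b])`),
  `βg3_single` (`= single F ([F = F′]·λ(x_F)•(h₀D + Dh₀ − aDb − bDa))`, `h₀ = ½(ab+ba)`).
* §2 **`MjetAt_gauge_single`**: `M^ρ_b(single F a, single F′ b; (dλ)•D)`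
  `= (2L^d)⁻¹ • ((hessCountAt F′ F + [F′=F] linCountAt F′) • [b, λ(x_F)•[D,a]])`
  `+ (2L^d)⁻¹ • ((hessCountAt F F′ + [F=F′] linCountAt F) • [a, λ(x_{F′})•[D,b]])`
  `+ L^{-d} • (linCountAt F • [F=F′]·λ(x_F)•(h₀D + Dh₀ − aDb − bDa))`
  `− ((λ(r)•D)·H − H·(λ(r)•D))`, `H = (2L^d)⁻¹ • (hessCountAt F F′ • [a,b])` (all counts rooted at `ρ`, read at `(μ, y)`).
Provenance: β sub-cell, unit beta-an2 gen 21, 2026-08-20 (v1); no existing file touched.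
-/

namespace Summit.QuantumFields.BalabanUV.Beta.MixedJetWardSingle

open Literature.MathematicalPhysics.QuantumFieldTheory.Balaban1983to89
open Literature.MathematicalPhysics.QuantumFieldTheory.Balaban1983to89.Beta
open AffineAveraging (Form1 unitVec)
open AveragingContoursRooted (ctr linAvgAt)
open AveragingHessianKernels (Bond single single_apply bw bw_single)
open AveragingHessianKernelsRooted (hessUAt linCountAt hessCountAt linAvgAt_single hessUAt_single)
open AveragingMixedJetTables (MjetAt)
open Summit.QuantumFields.BalabanUV.Beta.MixedJetWard (βg1 βg2 βg3 MjetAt_gauge_counts)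

variable {𝕜 : Type*} [Field 𝕜] {d : ℕ} {𝔸 : Type*} [Ring 𝔸] [Algebra 𝕜 𝔸]
variable (lam : (Fin d → ℤ) → 𝕜) (D : 𝔸)

/-! ## §1 The rotation-defect components at single letters -/

/-- [folklore] `β₁(single F a) = single F (λ(x_F)•[D, a])`. -/
theorem βg1_single (F : Bond d) (a : 𝔸) : βg1 lam D (single F a) = single F (lam F.2 • AveragingHessianKernels.comm D a) := by
  funext κ x
  simp only [βg1, single_apply]
  by_cases h : (κ, x) = F
  · rw [if_pos h, if_pos h, ← h, AveragingHessianKernels.comm, smul_mul_assoc, mul_smul_comm, smul_sub]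
  · rw [if_neg h, if_neg h, mul_zero, zero_mul, sub_self]

/-- [folklore] `β₂(single F′ b) = single F′ (λ(x_{F′})•[D, b])`. -/
theorem βg2_single (F' : Bond d) (b : 𝔸) : βg2 lam D (single F' b) = single F' (lam F'.2 • AveragingHessianKernels.comm D b) := by
  funext κ x
  simp only [βg2, single_apply]
  by_cases h : (κ, x) = F'
  · rw [if_pos h, if_pos h, ← h, AveragingHessianKernels.comm, smul_mul_assoc, mul_smul_comm, smul_sub]
  · rw [if_neg h, if_neg h, mul_zero, zero_mul, sub_self]

open Classical in
/-- [folklore] `β₃(single F a, single F′ b) = single F ([F = F′]·λ(x_F)•(h₀D + Dh₀ − aDb − bDa))`, `h₀ = ½(ab + ba)`. -/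
theorem βg3_single (F F' : Bond d) (a b : 𝔸) :
    βg3 (𝕜 := 𝕜) lam D (single F a) (single F' b)
      = single F (if F = F' then lam F.2 • (((2 : 𝕜)⁻¹ • (a * b + b * a)) * D + D * ((2 : 𝕜)⁻¹ • (a * b + b * a)) - a * D * b - b * D * a)
          else 0) := by
  funext κ x
  simp only [βg3, single_apply]
  by_cases h : (κ, x) = F
  · rw [if_pos h, if_pos h]
    by_cases h' : F = F'
    · have h2 : (κ, x) = F' := h.trans h'
      rw [if_pos h2, if_pos h', ← h]
      simp only [smul_mul_assoc, mul_smul_comm, smul_sub, smul_add, mul_add, add_mul, smul_smul, mul_comm (lam x) (2⁻¹ : 𝕜)]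
    · have h2 : ¬ (κ, x) = F' := fun e => h' (h.symm.trans e)
      rw [if_neg h2, if_neg h']
      simp
  · rw [if_neg h, if_neg h]
    simp

/-! ## §2 The jet Ward identity at single letters -/

open Classical in
/-- [folklore] **THE JET WARD IDENTITY OF node 12b's ROOTED MIXED JET AT SINGLE LETTERS, EVERY TERM A COUNT** (`(L:𝕜) ≠ 0`, char ≠ 2):
G2's `MjetAt_gauge_counts` with its contact functionals evaluated by node 7aρ's `hessUAt_single`∕`linAvgAt_single` and node 7a's `bw_single`. -/
theorem MjetAt_gauge_single {L : ℕ} (hL : (L : 𝕜) ≠ 0) (h2 : (2 : 𝕜) ≠ 0) (ρ : Fin d → ℤ) (F F' : Bond d) (a b : 𝔸) (μ : Fin d)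
    (y : Fin d → ℤ) :
    MjetAt 𝕜 ρ (single F a) (single F' b) (fun κ x => (lam (x + unitVec κ) - lam x) • D) L μ y
      = ((2 : 𝕜) * (L : 𝕜) ^ d)⁻¹ •
            ((hessCountAt ρ L μ y F' F • AveragingHessianKernels.comm b (lam F.2 • AveragingHessianKernels.comm D a))
              + (if F' = F then linCountAt ρ L μ y F' • AveragingHessianKernels.comm b (lam F.2 • AveragingHessianKernels.comm D a) else 0))
        + ((2 : 𝕜) * (L : 𝕜) ^ d)⁻¹ •
            ((hessCountAt ρ L μ y F F' • AveragingHessianKernels.comm a (lam F'.2 • AveragingHessianKernels.comm D b))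
              + (if F = F' then linCountAt ρ L μ y F • AveragingHessianKernels.comm a (lam F'.2 • AveragingHessianKernels.comm D b) else 0))
        + ((L : 𝕜) ^ d)⁻¹ • (linCountAt ρ L μ y F •
            (if F = F' then lam F.2 • (((2 : 𝕜)⁻¹ • (a * b + b * a)) * D + D * ((2 : 𝕜)⁻¹ • (a * b + b * a)) - a * D * b - b * D * a)
              else 0))
        - ((lam ((L : ℤ) • y + ρ) • D) * (((2 : 𝕜) * (L : 𝕜) ^ d)⁻¹ • (hessCountAt ρ L μ y F F' • AveragingHessianKernels.comm a b))
            - (((2 : 𝕜) * (L : 𝕜) ^ d)⁻¹ • (hessCountAt ρ L μ y F F' • AveragingHessianKernels.comm a b)) * (lam ((L : ℤ) • y + ρ) • D)) := by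
  rw [MjetAt_gauge_counts lam D hL h2, βg1_single, βg2_single, βg3_single, hessUAt_single, hessUAt_single, hessUAt_single, bw_single,
    bw_single, linAvgAt_single, linAvgAt_single, linAvgAt_single]
  congr 1
  congr 1
  congr 1
  · congr 1
    by_cases h : F' = F
    · rw [if_pos h, if_pos h]
    · rw [if_neg h, if_neg h, smul_zero]
  · congr 1
    by_cases h : F = F'
    · rw [if_pos h, if_pos h]
    · rw [if_neg h, if_neg h, smul_zero]

end Summit.QuantumFields.BalabanUV.Beta.MixedJetWardSingle
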